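import Literature.NumberTheory.LFunctions.BuiHall.Sign1
import HarnessLib

/-!
# Bui–Hall, Corollary 1: `HARDY(k,ℓ,m,n) = 0` for odd `k+ℓ+m+n` — PROVED from the explicit formula

LINE 1 — LABEL: RH-FREE (a theorem about explicit polynomial integrals — the sign of the main-term coefficient
`HARDY(k,ℓ,m,n)` of the mixed fourth moments of the derivatives of Hardy's `Z`); LADDER-RH materiality NIL
(director-rh 2026-08-27); class RECORDS → PAPERS. Nothing here bears on the truth of RH.

H. M. Bui, R. R. Hall, *On the derivatives of Hardy's function Z(t)*, Bull. LMS 55 (2023) 2304–2323 = arXiv:2304.05178 [BuiHall2023],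
§1 Corollary 1, AS PRINTED: «If k+ℓ+m+n is odd, then we have HARDY(k,ℓ,m,n) = 0.» (a consequence of their Theorem 3, the explicit
quadruple integral — the tree's `Literature.NumberTheory.LFunctions.BuiHall.HARDY`/`bhInt`, module `Sign1`). PROVED here
(`HARDY_eq_zero_of_odd`, `bhInt_eq_zero_of_odd`) by the reflection `(u₁,u₂) ↦ (1−u₁,1−u₂)` of the unit square, which fixes `(u₁−u₂)²`
and negates each of the four linear factors of the integrand, so the integral equals its own negative.

PROVENANCE (byte level). Port of §3 («vanishing for odd K») of the box file
`run/shared/lean/archive/2001-boxes/rh/summits/rh-w-lgap/free/y2/lean/LgapY2.lean` (leg 1 of the same 2001 box; its `bhInt`/`HARDY` are byte-identical to those of `BuiHallSign.lean` = `Sign1`);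
proof scripts verbatim; helpers made `private`; docstrings/tags added. Companion of the hub-kernel port of the Bui–Hall sign conjecture
(modules `Defs`, `Sign1–3`, `Certs…`, `Master…`, `Final` of this directory). Theorems only; no definitions beyond a private integrand.
-/

noncomputable section

namespace Literature.NumberTheory.LFunctions.BuiHall

open _root_.MeasureTheory intervalIntegral

/-- The integrand of Bui–Hall's quadruple integral (without the factor 3 and the unimodular prefactor). [folklore] -/
private noncomputable def body (k l m n : ℕ) (u1 u2 u3 u4 : ℝ) : ℝ :=
  (u1 - u2) ^ 2 * (1 / 2 + (u1 - u2) * u3 - u1) ^ k * (1 / 2 + (u2 - u1) * u3 - u2) ^ l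
    * (1 / 2 + (u1 - u2) * u4 - u1) ^ m * (1 / 2 + (u2 - u1) * u4 - u2) ^ n

/-- `bhInt` through `body` (definitional). [folklore] -/
private theorem bhInt_eq_body (k l m n : ℕ) :
    bhInt k l m n = 3 * ∫ u1 in (0:ℝ)..1, ∫ u2 in (0:ℝ)..1, ∫ u3 in (0:ℝ)..1, ∫ u4 in (0:ℝ)..1,
      body k l m n u1 u2 u3 u4 := rfl

/-- sign bookkeeping: an odd total number of sign changes. [folklore] -/
private lemma sign_flip {w a b c d : ℝ} {k l m n : ℕ} (h : Odd (k + l + m + n)) :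
    w * (-a) ^ k * (-b) ^ l * (-c) ^ m * (-d) ^ n = -(w * a ^ k * b ^ l * c ^ m * d ^ n) := by
  rw [neg_pow a, neg_pow b, neg_pow c, neg_pow d]
  have hs : ((-1 : ℝ)) ^ k * (-1) ^ l * (-1) ^ m * (-1) ^ n = -1 := by
    rw [← pow_add, ← pow_add, ← pow_add]; exact h.neg_one_pow
  calc w * ((-1) ^ k * a ^ k) * ((-1) ^ l * b ^ l) * ((-1) ^ m * c ^ m) * ((-1) ^ n * d ^ n)
      = w * a ^ k * b ^ l * c ^ m * d ^ n * (((-1 : ℝ)) ^ k * (-1) ^ l * (-1) ^ m * (-1) ^ n) := by ring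
    _ = -(w * a ^ k * b ^ l * c ^ m * d ^ n) := by rw [hs]; ring

/-- the substitution `(u₁,u₂) ↦ (1−u₁, 1−u₂)` fixes `(u₁−u₂)²` and negates each of the four linear factors. [folklore] -/
private lemma body_flip {k l m n : ℕ} (h : Odd (k + l + m + n)) (u1 u2 u3 u4 : ℝ) :
    body k l m n (1 - u1) (1 - u2) u3 u4 = - body k l m n u1 u2 u3 u4 := by
  unfold body
  have e0 : (1 - u1 - (1 - u2)) ^ 2 = (u1 - u2) ^ 2 := by ring
  have e1 : 1 / 2 + (1 - u1 - (1 - u2)) * u3 - (1 - u1) = -(1 / 2 + (u1 - u2) * u3 - u1) := by ring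
  have e2 : 1 / 2 + (1 - u2 - (1 - u1)) * u3 - (1 - u2) = -(1 / 2 + (u2 - u1) * u3 - u2) := by ring
  have e3 : 1 / 2 + (1 - u1 - (1 - u2)) * u4 - (1 - u1) = -(1 / 2 + (u1 - u2) * u4 - u1) := by ring
  have e4 : 1 / 2 + (1 - u2 - (1 - u1)) * u4 - (1 - u2) = -(1 / 2 + (u2 - u1) * u4 - u2) := by ring
  rw [e0, e1, e2, e3, e4]
  exact sign_flip h

/-- Reflection `x ↦ 1 - x` preserves `∫₀¹`. [folklore] -/
private lemma integral01_reflect (f : ℝ → ℝ) : (∫ x in (0:ℝ)..1, f (1 - x)) = ∫ x in (0:ℝ)..1, f x := by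
  rw [intervalIntegral.integral_comp_sub_left (a := 0) (b := 1) f 1]; norm_num

/-- The quadruple integral of Bui–Hall's Theorem 3 vanishes whenever `k+ℓ+m+n` is odd (reflection `(u₁,u₂) ↦ (1−u₁,1−u₂)`). [cite: BuiHall2023, §1 Cor. 1 (for the integral of Thm. 3; proof by reflection symmetry)] -/
theorem bhInt_eq_zero_of_odd {k l m n : ℕ} (h : Odd (k + l + m + n)) : bhInt k l m n = 0 := by
  rw [bhInt_eq_body]
  -- F u1 u2 := the inner double integral
  have hF : ∀ u1 u2 : ℝ,
      (∫ u3 in (0:ℝ)..1, ∫ u4 in (0:ℝ)..1, body k l m n (1 - u1) (1 - u2) u3 u4)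
        = -(∫ u3 in (0:ℝ)..1, ∫ u4 in (0:ℝ)..1, body k l m n u1 u2 u3 u4) := by
    intro u1 u2
    rw [← intervalIntegral.integral_neg]
    refine intervalIntegral.integral_congr (fun u3 _ => ?_)
    try simp only
    rw [← intervalIntegral.integral_neg]
    refine intervalIntegral.integral_congr (fun u4 _ => ?_)
    try simp only
    exact body_flip h u1 u2 u3 u4
  have hG : ∀ u1 : ℝ,
      (∫ u2 in (0:ℝ)..1, ∫ u3 in (0:ℝ)..1, ∫ u4 in (0:ℝ)..1, body k l m n (1 - u1) u2 u3 u4)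
        = -(∫ u2 in (0:ℝ)..1, ∫ u3 in (0:ℝ)..1, ∫ u4 in (0:ℝ)..1, body k l m n u1 u2 u3 u4) := by
    intro u1
    rw [← integral01_reflect (fun u2 => ∫ u3 in (0:ℝ)..1, ∫ u4 in (0:ℝ)..1, body k l m n (1 - u1) u2 u3 u4),
      ← intervalIntegral.integral_neg]
    refine intervalIntegral.integral_congr (fun u2 _ => ?_)
    try simp only
    exact hF u1 u2
  have hI : (∫ u1 in (0:ℝ)..1, ∫ u2 in (0:ℝ)..1, ∫ u3 in (0:ℝ)..1, ∫ u4 in (0:ℝ)..1, body k l m n u1 u2 u3 u4)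
      = -(∫ u1 in (0:ℝ)..1, ∫ u2 in (0:ℝ)..1, ∫ u3 in (0:ℝ)..1, ∫ u4 in (0:ℝ)..1, body k l m n u1 u2 u3 u4) := by
    conv_lhs => rw [← integral01_reflect
      (fun u1 => ∫ u2 in (0:ℝ)..1, ∫ u3 in (0:ℝ)..1, ∫ u4 in (0:ℝ)..1, body k l m n u1 u2 u3 u4)]
    rw [← intervalIntegral.integral_neg]
    refine intervalIntegral.integral_congr (fun u1 _ => ?_)
    try simp only
    exact hG u1
  have hzero : (∫ u1 in (0:ℝ)..1, ∫ u2 in (0:ℝ)..1, ∫ u3 in (0:ℝ)..1, ∫ u4 in (0:ℝ)..1,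
      body k l m n u1 u2 u3 u4) = 0 := by linarith
  rw [hzero]; ring

/-- **Bui–Hall, Corollary 1, AS PRINTED: «If k+ℓ+m+n is odd, then we have HARDY(k,ℓ,m,n) = 0.»** — PROVED from the explicit
formula (Thm. 3, the definition `HARDY` of `Sign1`) by the reflection `(u₁,u₂) ↦ (1−u₁,1−u₂)`, which fixes `(u₁−u₂)²` and negates
each of the four linear factors. (Port of the box leg-1 file `LgapY2.lean` §3, whose `bhInt`/`HARDY` are byte-identical to `Sign1`'s.)
[cite: BuiHall2023, §1 Cor. 1] -/
theorem HARDY_eq_zero_of_odd {k l m n : ℕ} (h : Odd (k + l + m + n)) : HARDY k l m n = 0 := by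
  unfold HARDY; rw [bhInt_eq_zero_of_odd h]; simp

end Literature.NumberTheory.LFunctions.BuiHall
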